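import Summits.RiemannHypothesis.RiemannHypothesis.Theorems.WeilFormatCDataO94FrontData
import Summits.RiemannHypothesis.RiemannHypothesis.Theorems.S2FormatCE0
import Literature.NumberTheory.LFunctions.YoshidaWindowGramTailMSSines
import Literature.NumberTheory.LFunctions.YoshidaWindowGramMiddleJBox
import Literature.NumberTheory.LFunctions.YoshidaWindowGramTailJFactoredScaled
import Literature.NumberTheory.LFunctions.YoshidaWindowGramTailMSFactored
import Literature.NumberTheory.LFunctions.YoshidaWindowGramTailJDiagTight
import Summits.RiemannHypothesis.RiemannHypothesis.Theorems.FormatCPsdBands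
import Summits.RiemannHypothesis.RiemannHypothesis.Theorems.WeilFormatCDiagShift
import HarnessLib

/-!
# Format C kernel rung `O94` (a = 47/50, column-band layout): odd sector: Schur rows 112…116 (lower triangle) of `M − U₁ − U₂` enclosed by `DS` within `rho`·2^-250 (kernel certificates)

Window `a = 47/50`; prime powers in the window: 2, 3, 2^2, 5; prime constant A = 1825/1000 (`WeilFormatC.primeCoeff_form_ge_cells_09729`); evaluator parameters S = 2^256, Kpi 130, Kser 150, kred 8, Kexp 45, J 120; full table modes < 161; light column table modes < 1027; units 2^-250 (Schur entries), 2^-124 (column digits, width 127), 2^-118 (tail-factor digits, width 121), 2^-64 (reciprocal weights), 2^-40 (tail base); order-J tail J = 4, θ = 1/2048, η = 1/10 | 4/1.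
Design row: sr-gb-rung-a odd λ-run (parity cell 10 L-side): a = 47/50, μ = 2^-75, odd 160/320/1024, MS tail; see HOME(A)/LADDER-LSIDES-FORMATC-A-g22.md. Generated by sr-gb-rung-a prover A g22 with rh-explicit-weil-2 gen7's generator extended for the odd λ-run (--sector odd --mu-log2; HOME(A)/code-g22/gen7/gramgen7.py sha16 172ee47dc0b1c923) from `#eval` of the tree's `Encl` functions; every datum is re-verified by the kernel in the theorem files (`decide +kernel`). Helper data of the rh-explicit Weil-positivity programme (format C, K-CELL-2), RH-free. [cite: Yoshida1992HermitianForms, §5 (5.15)-(5.16) p. 301; §7 pp. 305–312]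
-/

set_option linter.dupNamespace false
set_option maxRecDepth 200000

namespace Summit.RiemannHypothesis.RiemannHypothesis.Theorems.WeilFormatCData.O94CBOdd
open Literature.NumberTheory.LFunctions Literature.NumberTheory.LFunctions.Yoshida1992 Encl Literature.Analysis.ValidatedNumerics.NumericsMP
open Summit.RiemannHypothesis.RiemannHypothesis.Theorems.WeilFormatCData.O94

/-- kernel: Schur rows `[112, 117)` (columns `j ≤ i`). -/
theorem tS112 : checkSchurBandG (2 ^ 256) 250 O94CBOdd.rho O94.C O94.tab true 160 (subBoxCB (2 ^ 256) 127 160 124 64 O94CBOdd.ρc O94CBOdd.XP O94CBOdd.Pd O94CBOdd.v O94CBOdd.V 121 8 118 118 O94CBOdd.ρφ O94CBOdd.ρψ O94CBOdd.ΦP O94CBOdd.ΨP O94CBOdd.Pφ O94CBOdd.Pψ (fun i ↦ (dMidOBox (2 ^ 256) O94.C O94.F (tget O94.tab (i + 1)) 1 1024 160 4 O94.momO i).add (dgJoBoxT (2 ^ 256) O94.C O94.F (tget O94.tab (i + 1)) 40 1563711840992 160 1024 4 1 2048 i))) O94CBOdd.DS true 112 5 = true := by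
  decide +kernel

end Summit.RiemannHypothesis.RiemannHypothesis.Theorems.WeilFormatCData.O94CBOdd
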